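/-
Copyright (c) 2026 the pub-hodgecm-mathlib formalisation cell (harness21).  Prover seat hodgecm-mathlib-LH4-p12 (g9), req620 Track A «(D-RAM) FOUR-FRAME» squad
(STAGE-1b, row (2) of the piece `f_{T₊}`, the (β₂) road (R-36) «PURE-CELL LEDGER»; K6 desk LH4-p16 (g3) WORD #1 (d) ∕ WORD #10 «F1-ODD-bd in the TOP chart»; the ON-SHELL
(`g = 0` admissible) twin of LH4-p16 (g2)'s ★ p862927 `…AffineLabelAnyParity.exists_affineLabel_of_coords_any`), 2026-09-05.
-/
import Summits.HodgeConjecture.HodgeConjecture.Theorems.F0P3cDyRamAffineLabelAnyParity        -- ★ p862927 (LH4-p16 (g2)): the `1 ≤ g` dictionary; brings ★ `v_refSkew_eq`, ★ `v_fst_eq_of_fixed_coords`, ★ Lit `WildQuadraticEisensteinFrame`, ★ `normSign_eq_of_near`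
import HarnessLib

/-!
# Crux `H413`, line LH4 «(D-RAM) FOUR-FRAME» — STAGE-1b, row (2), the (β₂) road (R-36), K6 road: «THE AFFINE LABEL ON THE SHELL» — ★ p862927's dictionary `ω(f) = ω(T̂)·ω(α₁ + γ₁V)`
# WITHOUT `1 ≤ g`, for the digits `V` ON THE SHELL `|â + b̂V| = |â|` (the top window cell of a row tower, where the digit term `b̂V` is as large as the main term `â`)

Cell `hodgecm-mathlib` (D-0151), FLOOR 0, crux item H413 = `stmt-HodgeConjecture-24833`, route of record `HCCMUnconditional`; squad F0∕P3c∕LH4; lane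
`--supports stmt-HodgeConjecture-24833 --as helper` (count-neutral; pays NO tier-0 row).  THEOREMS ONLY (no `def`, no instance, no notation, no `sorry`, default heartbeats);
★-only imports; states NO law; (β₂) stays a HYPOTHESIS.  `E`-side only: a complete sheet datum `IsRamifiedQuadraticDatum σ ϖ d t` with finite residue field, `d` of ANY parity.

WHY (K6 desk LH4-p16 (g3) WORD #10, 2026-09-05 02:16Z: «for F1-ODD-bd use the TOP chart»).  In the TOP chart of a row tower (`|ξ₀| = exp 2N`, `N = (jl − m)∕2`) the slope letter reads
`g = 0`: on the top window cell `j + b + 1 = jl` of the odd row the digit term `b̂·V = μ_bγ₀(ϖσϖ)^{−b}·V` has the SAME size as the main term `â = (μ_a + μ_bR₀)(ϖσϖ)^{−b}`, the ray scalar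
`e₀ = pw·(â + b̂V)·(ϖσϖ)^b` (★ p862871 `rayScalar_eq_affine`) has `|e₀|` VARYING with the unit digit `V`, and a glued vertex is on the `(1, M)`-shell iff `|e₀| = |ϖ|` (★ p864193 HEAD-bd) iff
`|â + b̂V| = |â|`.  ★ p862927 uses `1 ≤ g` at ONE place: `|γ₁V| < |α₁|` ⇒ the affine part `f₀ = T̂(α₁ + γ₁V)` is a unit.  ON THE SHELL that unit property holds at `g = 0` too:
`T̂(â + b̂V)∕t₊ = f₀ + Y·ϖ` with `f₀`, `Y` fixed (★ Lit `exists_fixed_coords_of_map_ne`), `|f₀ + Yϖ| = max |f₀| |Yϖ|` (★ Lit `v_fixed_add_fixed_mul_eq_max`: a fixed element has even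
`log |·|`, so the `ϖ`-tail cannot cancel), and `|Yϖ| ≠ 1` (odd `log`) — so `|â + b̂V| = |â|` forces `|f₀| = 1`, and the rest of ★ p862927's proof runs verbatim.
THIS FILE, TWO theorems (§2 = ED. 2):
* HEAD `exists_affineLabel_of_coords_onShell` — ★ p862927's statement with `hg1 : 1 ≤ g` DROPPED and ONE premise `Valued.v (â + bh * V) = Valued.v â →` INSERTED in the ∀-clause (after
  `σ f = f →`).  At `1 ≤ g` the premise is automatic (`|b̂V| < |â|`), so ★ p862927 is this theorem's corollary (not restated).  Consumers: «M1-NX» `…RowVertexAffineSignLabelOnShell`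
  (the label read of a top-cell vertex ON the shell) and the K6 assembler's top-chart dictionary for F1-ODD-bd (LH4-p12) ∕ the spine's glue (LH4-p16).
* HEAD-U (ED. 2) `exists_affineLabel_of_coords_onShell_unit` — the same `∃ α₁ γ₁` with the UNIT LETTER `∀ V, σV = V → |V| ≤ 1 → |â + b̂V| = |â| → |α₁ + γ₁V| = 1` exported as an
  extra conjunct (F1b-top's `hαγ`: the label is locally constant on digits only ON the shell).
WHAT IS NOT CLAIMED: anything off the shell (there `f₀` is not a unit and `ω(f)` is not an affine sign of `V`); the coordinates; any count or census law.
HONEST LABEL.  Count-neutral `E`-algebra; nothing printed is asserted; no census law is stated; `HC_CM` is proved only modulo the 7 printed citations (2 remaining named inputs: hLiu418 =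
`stmt-HodgeConjecture-24832`, h413 = `stmt-HodgeConjecture-24833`) until rung 0 closes.
## References
* [Serre1979] J.-P. Serre, *Local Fields*, GTM 67 (1979): Ch. I §6 Prop. 18 (Eisenstein bases), Ch. V §3 Cor. 3 pp. 85–87, Ch. XIV §2–§3 (the norm residue symbol on `U^{(n)}`).
* [Rogawski1990] J. D. Rogawski, Ann. of Math. Stud. 123 (1990): §4.9 Prop. 4.9.1 (b) p. 55; [LanglandsShelstad1987] R. P. Langlands, D. Shelstad, Math. Ann. 278 (1987): §1–§3.
-/

set_option autoImplicit false

noncomputable section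

namespace Summit.HodgeConjecture.HodgeConjecture.Cruxes.H413.F0P3cDyRamAffineLabelOnShell

open scoped Valued WithZero
open WithZero
open Literature.NumberTheory.Automorphic.UnitaryThreeFourFrame (IsRamifiedQuadraticDatum normSign)
open Literature.NumberTheory.LocalFields (exists_fixed_coords_of_map_ne v_fixed_add_fixed_mul_eq_max)
open Literature.NumberTheory.LocalFields.WildQuadraticDatum (v_varpi_pow even_log_v_of_fixed map_varpi_ne normSign_eq_of_near normSign_mul_of_fixed)
open Summit.HodgeConjecture.HodgeConjecture.Cruxes.H413.F0P3cDyRamFourFramePieces (mstarOfRecord)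
open Summit.HodgeConjecture.HodgeConjecture.Cruxes.H413.F0P3cDyRamLabelShellFlipCardTwo (v_refSkew_eq)
open Summit.HodgeConjecture.HodgeConjecture.Cruxes.H413.F0P3cDyRamDiagonalCellAffineLabel (v_fst_eq_of_fixed_coords)

variable {K : Type} [Field K] [Valued K ℤᵐ⁰] {σ : K →+* K} {ϖ : K} {d t : ℕ}

/-! ## HEAD — the affine label on the shell `|â + b̂V| = |â|`, any `g` (incl. `g = 0`), any parity of `d` -/

/-- **HEAD — «THE AFFINE LABEL ON THE SHELL».**  At a complete sheet datum `IsRamifiedQuadraticDatum σ ϖ d t` with finite residue field (`d` of ANY parity; `t₊ = (ϖ − σϖ)((ϖσϖ)^{⌊d∕2⌋})⁻¹`,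
`|t₊| = |ϖ|^{d%2}`), for `â, b̂` with `|â| = |ϖ|^{d%2}`, `|b̂| = |ϖ|^{2g + d%2}` (`g` ARBITRARY, `g = 0` allowed), there are `σ`-FIXED `α₁, γ₁` with `|α₁| = 1`, `|γ₁| = |ϖ|^{2g}` such that
for every `σ`-fixed unit `T̂`, `σ`-fixed integer `V` ON THE SHELL `|â + b̂·V| = |â|`, and `σ`-fixed `f` with `|T̂·(â + b̂·V) − f·t₊| ≤ |ϖ|^{m*}`: **`ω(f) = ω(T̂)·ω(α₁ + γ₁V)`**
(★ p862927 `exists_affineLabel_of_coords_any` is the case `1 ≤ g`, where the shell premise is automatic). [cite: Serre1979, Ch. I §6 Prop. 18] [cite: Serre1979, Ch. V §3 Cor. 3 pp. 85–87]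
[cite: Serre1979, Ch. XIV §2–§3] [cite: Rogawski1990, §4.9 Prop. 4.9.1 (b) p. 55] [cite: LanglandsShelstad1987, §1–§3] -/
theorem exists_affineLabel_of_coords_onShell [CompleteSpace K] [Finite 𝓀[K]] (hD : IsRamifiedQuadraticDatum σ ϖ d t)
    {â bh : K} (hâ : Valued.v â = Valued.v ϖ ^ (d % 2)) {g : ℕ} (hbh : Valued.v bh = Valued.v ϖ ^ (2 * g + d % 2)) :
    ∃ α₁ γ₁ : K, σ α₁ = α₁ ∧ Valued.v α₁ = 1 ∧ σ γ₁ = γ₁ ∧ Valued.v γ₁ = Valued.v ϖ ^ (2 * g) ∧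
      ∀ (T V f : K), σ T = T → Valued.v T = 1 → σ V = V → Valued.v V ≤ 1 → σ f = f → Valued.v (â + bh * V) = Valued.v â →
        Valued.v (T * (â + bh * V) - f * ((ϖ - σ ϖ) * ((ϖ * σ ϖ) ^ ((d - d % 2) / 2))⁻¹)) ≤ Valued.v ϖ ^ mstarOfRecord d →
        normSign σ f = normSign σ T * normSign σ (α₁ + γ₁ * V) := by
  obtain ⟨hσσ, hvσ, hϖ, hfix, hdd, hd1, ht⟩ := id hD
  have hvt : Valued.v ((ϖ - σ ϖ) * ((ϖ * σ ϖ) ^ ((d - d % 2) / 2))⁻¹) = Valued.v ϖ ^ (d % 2) := v_refSkew_eq hvσ hϖ hdd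
  have hfix' : ∀ c : K, σ c = c → c ≠ 0 → Even (log (Valued.v c)) := fun c hc hc0 => even_log_v_of_fixed hfix c hc hc0
  have hvϖ0 : Valued.v ϖ ≠ 0 := by rw [hϖ]; exact exp_ne_zero
  have hϖlt : Valued.v ϖ < 1 := by rw [hϖ, ← exp_zero, exp_lt_exp]; norm_num
  have hϖσ : σ ϖ ≠ ϖ := map_varpi_ne hϖ hdd
  set tp : K := (ϖ - σ ϖ) * ((ϖ * σ ϖ) ^ ((d - d % 2) / 2))⁻¹ with htp
  have hvt0 : Valued.v tp ≠ 0 := by rw [hvt]; exact pow_ne_zero _ hvϖ0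
  have htp0 : tp ≠ 0 := (Valuation.ne_zero_iff _).1 hvt0
  -- Eisenstein coordinates of `â/t₊` (a unit) and `b̂/t₊` (valuation `2g`), as in ★ p862927
  obtain ⟨α₁, y₁, hα₁, hy₁, hα⟩ := exists_fixed_coords_of_map_ne hσσ hϖσ (â / tp)
  obtain ⟨γ₁, y₂, hγ₁, hy₂, hγ⟩ := exists_fixed_coords_of_map_ne hσσ hϖσ (bh / tp)
  have hα1 : Valued.v α₁ = 1 := by
    have h := v_fst_eq_of_fixed_coords hD hα₁ hy₁ (n := 0) (by rw [← hα, map_div₀, hâ, hvt, div_self (pow_ne_zero _ hvϖ0)]; norm_num)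
    rw [h]; norm_num
  have hγ1 : Valued.v γ₁ = Valued.v ϖ ^ (2 * g) := by
    have h := v_fst_eq_of_fixed_coords hD hγ₁ hy₂ (n := -(g : ℤ))
      (by rw [← hγ, map_div₀, hbh, hvt, pow_add, mul_div_cancel_right₀ _ (pow_ne_zero _ hvϖ0), v_varpi_pow hϖ]; push_cast; ring_nf)
    rw [h, v_varpi_pow hϖ]; push_cast; ring_nf
  refine ⟨α₁, γ₁, hα₁, hα1, hγ₁, hγ1, fun T V f hσT hT1 hσV _hV1 hσf hshell hsf => ?_⟩
  have hT0 : T ≠ 0 := fun h0 => by rw [h0, map_zero] at hT1; exact zero_ne_one hT1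
  -- the affine part `f₀` and the tail `Y`
  set f₀ : K := T * (α₁ + γ₁ * V) with hf₀
  set Y : K := T * (y₁ + y₂ * V) with hY
  have hσf₀ : σ f₀ = f₀ := by rw [hf₀, map_mul, map_add, map_mul, hσT, hα₁, hγ₁, hσV]
  have hσY : σ Y = Y := by rw [hY, map_mul, map_add, map_mul, hσT, hy₁, hy₂, hσV]
  have hdec : T * (â + bh * V) / tp = f₀ + Y * ϖ := by
    have e1 : â = (α₁ + y₁ * ϖ) * tp := by rw [← hα, div_mul_cancel₀ â htp0]
    have e2 : bh = (γ₁ + y₂ * ϖ) * tp := by rw [← hγ, div_mul_cancel₀ bh htp0]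
    rw [e1, e2, hf₀, hY]; field_simp; ring
  -- ON THE SHELL `|f₀| = 1`: `|f₀ + Yϖ| = |T̂(â + b̂V)∕t₊| = 1` and the `ϖ`-tail has odd `log`, so it is not the maximum
  have hYϖ1 : Valued.v Y * exp (-1 : ℤ) ≠ 1 := by
    intro h1
    by_cases hY0 : Y = 0
    · rw [hY0, map_zero, zero_mul] at h1; exact zero_ne_one h1
    · obtain ⟨n, hn⟩ := hfix Y hσY hY0
      rw [hn, ← exp_add, ← exp_zero, exp_inj] at h1
      omega
  have hf₀1 : Valued.v f₀ = 1 := by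
    have h1 : Valued.v (f₀ + Y * ϖ) = 1 := by
      rw [← hdec, map_div₀, Valuation.map_mul, hshell, hT1, one_mul, hâ, hvt, div_self (pow_ne_zero _ hvϖ0)]
    rw [v_fixed_add_fixed_mul_eq_max hfix' hϖ hσf₀ hσY] at h1
    rcases max_choice (Valued.v f₀) (Valued.v Y * exp (-1 : ℤ)) with h | h
    · rw [h] at h1; exact h1
    · rw [h] at h1; exact absurd h1 hYϖ1
  -- `|f₀ − f| ≤ |ϖ|^{2d−1}` (the near-letter divided by `|t₊| = |ϖ|^{d%2}`), as in ★ p862927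
  have hnear : Valued.v (f₀ - f) ≤ Valued.v ϖ ^ (2 * d - 1) := by
    have h1 : Valued.v (T * (â + bh * V) / tp - f) ≤ Valued.v ϖ ^ (2 * d - 1) := by
      have e : T * (â + bh * V) / tp - f = (T * (â + bh * V) - f * tp) / tp := by field_simp
      rw [e, map_div₀, hvt, div_le_iff₀ (zero_lt_iff.2 (pow_ne_zero _ hvϖ0)), ← pow_add]
      refine hsf.trans (le_of_eq ?_)
      simp only [mstarOfRecord]; congr 1; omega
    rw [hdec] at h1
    have e2 : f₀ + Y * ϖ - f = (f₀ - f) + Y * ϖ := by ring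
    rw [e2, v_fixed_add_fixed_mul_eq_max hfix' hϖ (by rw [map_sub, hσf₀, hσf]) hσY] at h1
    exact (le_max_left _ _).trans h1
  rw [normSign_eq_of_near hD hσf₀ hσf hf₀1 (n := 2 * d - 1) le_rfl hnear, hf₀]
  have hαV0 : α₁ + γ₁ * V ≠ 0 := fun h0 => by
    rw [hf₀, h0, mul_zero, map_zero] at hf₀1; exact zero_ne_one hf₀1
  exact normSign_mul_of_fixed hD hσT (by rw [map_add, map_mul, hα₁, hγ₁, hσV]) hT0 hαV0

/-! ## §2 (ED. 2) The same dictionary WITH the unit letter exported: on the shell `|α₁ + γ₁V| = 1` -/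

/-- **HEAD-U — «THE AFFINE LABEL ON THE SHELL, WITH ITS UNIT LETTER».**  §1's statement with ONE MORE conjunct before the dictionary clause: for every `σ`-fixed integral `V` ON THE SHELL
`|â + b̂V| = |â|`, **`|α₁ + γ₁V| = 1`** (the affine part is a unit — §1's proof shows exactly this on the way).  The K6 socket needs it at the top cell: there `|γ₁| = 1`, and the label
`ω(α₁ + γ₁V)` is locally constant (★ Lit `normSign_eq_of_near`) only where `α₁ + γ₁V` is a unit, i.e. ON the shell — this letter is the `hαγ` input of F1b-top.
[cite: Serre1979, Ch. I §6 Prop. 18] [cite: Serre1979, Ch. V §3 Cor. 3 pp. 85–87] [cite: Serre1979, Ch. XIV §2–§3] [cite: Rogawski1990, §4.9 Prop. 4.9.1 (b) p. 55] -/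
theorem exists_affineLabel_of_coords_onShell_unit [CompleteSpace K] [Finite 𝓀[K]] (hD : IsRamifiedQuadraticDatum σ ϖ d t)
    {â bh : K} (hâ : Valued.v â = Valued.v ϖ ^ (d % 2)) {g : ℕ} (hbh : Valued.v bh = Valued.v ϖ ^ (2 * g + d % 2)) :
    ∃ α₁ γ₁ : K, σ α₁ = α₁ ∧ Valued.v α₁ = 1 ∧ σ γ₁ = γ₁ ∧ Valued.v γ₁ = Valued.v ϖ ^ (2 * g) ∧
      (∀ V : K, σ V = V → Valued.v V ≤ 1 → Valued.v (â + bh * V) = Valued.v â → Valued.v (α₁ + γ₁ * V) = 1) ∧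
      ∀ (T V f : K), σ T = T → Valued.v T = 1 → σ V = V → Valued.v V ≤ 1 → σ f = f → Valued.v (â + bh * V) = Valued.v â →
        Valued.v (T * (â + bh * V) - f * ((ϖ - σ ϖ) * ((ϖ * σ ϖ) ^ ((d - d % 2) / 2))⁻¹)) ≤ Valued.v ϖ ^ mstarOfRecord d →
        normSign σ f = normSign σ T * normSign σ (α₁ + γ₁ * V) := by
  obtain ⟨hσσ, hvσ, hϖ, hfix, hdd, hd1, ht⟩ := id hD
  have hvt : Valued.v ((ϖ - σ ϖ) * ((ϖ * σ ϖ) ^ ((d - d % 2) / 2))⁻¹) = Valued.v ϖ ^ (d % 2) := v_refSkew_eq hvσ hϖ hdd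
  have hfix' : ∀ c : K, σ c = c → c ≠ 0 → Even (log (Valued.v c)) := fun c hc hc0 => even_log_v_of_fixed hfix c hc hc0
  have hvϖ0 : Valued.v ϖ ≠ 0 := by rw [hϖ]; exact exp_ne_zero
  have hϖσ : σ ϖ ≠ ϖ := map_varpi_ne hϖ hdd
  set tp : K := (ϖ - σ ϖ) * ((ϖ * σ ϖ) ^ ((d - d % 2) / 2))⁻¹ with htp
  have hvt0 : Valued.v tp ≠ 0 := by rw [hvt]; exact pow_ne_zero _ hvϖ0
  have htp0 : tp ≠ 0 := (Valuation.ne_zero_iff _).1 hvt0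
  obtain ⟨α₁, y₁, hα₁, hy₁, hα⟩ := exists_fixed_coords_of_map_ne hσσ hϖσ (â / tp)
  obtain ⟨γ₁, y₂, hγ₁, hy₂, hγ⟩ := exists_fixed_coords_of_map_ne hσσ hϖσ (bh / tp)
  have hα1 : Valued.v α₁ = 1 := by
    have h := v_fst_eq_of_fixed_coords hD hα₁ hy₁ (n := 0) (by rw [← hα, map_div₀, hâ, hvt, div_self (pow_ne_zero _ hvϖ0)]; norm_num)
    rw [h]; norm_num
  have hγ1 : Valued.v γ₁ = Valued.v ϖ ^ (2 * g) := by
    have h := v_fst_eq_of_fixed_coords hD hγ₁ hy₂ (n := -(g : ℤ))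
      (by rw [← hγ, map_div₀, hbh, hvt, pow_add, mul_div_cancel_right₀ _ (pow_ne_zero _ hvϖ0), v_varpi_pow hϖ]; push_cast; ring_nf)
    rw [h, v_varpi_pow hϖ]; push_cast; ring_nf
  -- the decomposition `(â + b̂V)∕t₊ = (α₁ + γ₁V) + (y₁ + y₂V)·ϖ` and the UNIT LETTER on the shell
  have hdec0 : ∀ V : K, (â + bh * V) / tp = (α₁ + γ₁ * V) + (y₁ + y₂ * V) * ϖ := by
    intro V
    have e1 : â = (α₁ + y₁ * ϖ) * tp := by rw [← hα, div_mul_cancel₀ â htp0]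
    have e2 : bh = (γ₁ + y₂ * ϖ) * tp := by rw [← hγ, div_mul_cancel₀ bh htp0]
    rw [e1, e2]; field_simp; ring
  have hunit : ∀ V : K, σ V = V → Valued.v (â + bh * V) = Valued.v â → Valued.v (α₁ + γ₁ * V) = 1 := by
    intro V hσV hshell
    have hσg : σ (α₁ + γ₁ * V) = α₁ + γ₁ * V := by rw [map_add, map_mul, hα₁, hγ₁, hσV]
    have hσY : σ (y₁ + y₂ * V) = y₁ + y₂ * V := by rw [map_add, map_mul, hy₁, hy₂, hσV]
    have hYϖ1 : Valued.v (y₁ + y₂ * V) * exp (-1 : ℤ) ≠ 1 := by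
      intro h1
      by_cases hY0 : y₁ + y₂ * V = 0
      · rw [hY0, map_zero, zero_mul] at h1; exact zero_ne_one h1
      · obtain ⟨n, hn⟩ := hfix _ hσY hY0
        rw [hn, ← exp_add, ← exp_zero, exp_inj] at h1
        omega
    have h1 : Valued.v ((α₁ + γ₁ * V) + (y₁ + y₂ * V) * ϖ) = 1 := by
      rw [← hdec0, map_div₀, hshell, hâ, hvt, div_self (pow_ne_zero _ hvϖ0)]
    rw [v_fixed_add_fixed_mul_eq_max hfix' hϖ hσg hσY] at h1
    rcases max_choice (Valued.v (α₁ + γ₁ * V)) (Valued.v (y₁ + y₂ * V) * exp (-1 : ℤ)) with h | h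
    · rw [h] at h1; exact h1
    · rw [h] at h1; exact absurd h1 hYϖ1
  refine ⟨α₁, γ₁, hα₁, hα1, hγ₁, hγ1, fun V hσV _ hshell => hunit V hσV hshell, fun T V f hσT hT1 hσV _hV1 hσf hshell hsf => ?_⟩
  have hT0 : T ≠ 0 := fun h0 => by rw [h0, map_zero] at hT1; exact zero_ne_one hT1
  set f₀ : K := T * (α₁ + γ₁ * V) with hf₀
  set Y : K := T * (y₁ + y₂ * V) with hY
  have hσf₀ : σ f₀ = f₀ := by rw [hf₀, map_mul, map_add, map_mul, hσT, hα₁, hγ₁, hσV]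
  have hσY : σ Y = Y := by rw [hY, map_mul, map_add, map_mul, hσT, hy₁, hy₂, hσV]
  have hdec : T * (â + bh * V) / tp = f₀ + Y * ϖ := by rw [mul_div_assoc, hdec0, hf₀, hY]; ring
  have hf₀1 : Valued.v f₀ = 1 := by rw [hf₀, Valuation.map_mul, hT1, hunit V hσV hshell, one_mul]
  have hnear : Valued.v (f₀ - f) ≤ Valued.v ϖ ^ (2 * d - 1) := by
    have h1 : Valued.v (T * (â + bh * V) / tp - f) ≤ Valued.v ϖ ^ (2 * d - 1) := by
      have e : T * (â + bh * V) / tp - f = (T * (â + bh * V) - f * tp) / tp := by field_simp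
      rw [e, map_div₀, hvt, div_le_iff₀ (zero_lt_iff.2 (pow_ne_zero _ hvϖ0)), ← pow_add]
      refine hsf.trans (le_of_eq ?_)
      simp only [mstarOfRecord]; congr 1; omega
    rw [hdec] at h1
    have e2 : f₀ + Y * ϖ - f = (f₀ - f) + Y * ϖ := by ring
    rw [e2, v_fixed_add_fixed_mul_eq_max hfix' hϖ (by rw [map_sub, hσf₀, hσf]) hσY] at h1
    exact (le_max_left _ _).trans h1
  rw [normSign_eq_of_near hD hσf₀ hσf hf₀1 (n := 2 * d - 1) le_rfl hnear, hf₀]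
  have hαV0 : α₁ + γ₁ * V ≠ 0 := fun h0 => by
    rw [hf₀, h0, mul_zero, map_zero] at hf₀1; exact zero_ne_one hf₀1
  exact normSign_mul_of_fixed hD hσT (by rw [map_add, map_mul, hα₁, hγ₁, hσV]) hT0 hαV0

end Summit.HodgeConjecture.HodgeConjecture.Cruxes.H413.F0P3cDyRamAffineLabelOnShell

end
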